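import Summits.BirchSwinnertonDyer.BirchSwinnertonDyer.Theses.UniversalToricDescent
import Summits.BirchSwinnertonDyer.BirchSwinnertonDyer.Theorems.UniversalToricDescentTwinSplitIMCAtThreeGoodOrdIntegral
import HarnessLib

/-!
# Route `UniversalToricDescent`: the support child `TwinSplitIMCAtThreeGoodOrdOfPrint`
# (item stmt-BirchSwinnertonDyer-20693, child of crux #3 `TwinSplitIMCAtThree` 20214, route rev 17) — CLOSED

Seat `bsd-wall-utd-p2` g2 (D-0131 (3) MIDDLE tier). The child says: the three refereed named facts (BCS 2025
Thm. 4.2.1 (b); Yan–Zhu 2026 Thm. 5.7 (1); BCS 2025 Prop. 4.2.2) imply conjuncts (i) ∧ (ii) of crux #3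
VERBATIM for every GOOD-ORDINARY twin `W′` at `3` with `ρ̄₃` onto over `ℚ` and every Heegner `K` with `3`
split and `d_K` odd (census bucket A = 745 of the 2 023 twin classes). This is exactly seat g0's landed
`…Theorems.UniversalToricDescentTwinSplit.twinSplit_instance_of_goodOrd` (p540959: `⊇` integrally from
Thm. 4.2.1 (b), `⊆` rationally from Thm. 5.7 (1), `μ = 0` from Prop. 4.2.2, the three frames identified by
the integral cross-period rigidity p536114, prime avoidance by `3 ∈ R₀⟦T⟧`). One `exact`; the facts are the
child's OWN antecedents, so this theorem is UNCONDITIONAL (the facts are not hypotheses of the file).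
Beyond-print BSD theorem: NO. `--workitem stmt-BirchSwinnertonDyer-20693`.

References: [BurungaleCastellaSkinner2025] Thm. 4.2.1 (b), Prop. 4.2.2 (arXiv:2405.00270v2 pp. 8–9);
[YanZhu2024MainConjNonCM] Thm. 5.7 (1) (J. Algebra 693 (2026)); memo HOME/bsd-wall/bsd-wall-utd-p2/SUPSET-AT3-v3.md.
-/

noncomputable section

open scoped Classical

set_option linter.dupNamespace false
set_option autoImplicit false

namespace Summit.BirchSwinnertonDyer.BirchSwinnertonDyer.Theorems

/-- **Child `TwinSplitIMCAtThreeGoodOrdOfPrint` of crux #3 (item 20693) holds**: the three refereed facts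
⟹ crux #3 (i) ∧ (ii) verbatim at every good-ordinary twin with `ρ̄₃` onto over `ℚ` and every Heegner `K`
with `3` split and `d_K` odd — by `UniversalToricDescentTwinSplit.twinSplit_instance_of_goodOrd` (p540959).
[cite: BurungaleCastellaSkinner2025, Thm. 4.2.1 (b) and Prop. 4.2.2 (§4.2, pp. 8–9 of arXiv:2405.00270v2)]
[cite: YanZhu2024MainConjNonCM, Thm. 5.7 (1) (§5.2; J. Algebra 693 (2026))] -/
theorem twinSplitIMCAtThreeGoodOrdOfPrint_proof :
    Summit.BirchSwinnertonDyer.BirchSwinnertonDyer.Theses.UniversalToricDescent.TwinSplitIMCAtThreeGoodOrdOfPrint := by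
  intro h421 h57 h422 W' _ _ N' _ K _ _ Dt' hord hsurj _ hK hH hodd κ hκ γ _ 𝔭 h𝔭 he hf 𝔭' h𝔭' hne ι' hι'
  exact UniversalToricDescentTwinSplit.twinSplit_instance_of_goodOrd h421 h57 h422 W' N' K Dt' hord hsurj
    hK hH hodd κ hκ γ 𝔭 h𝔭 he hf 𝔭' h𝔭' hne ι' hι'

end Summit.BirchSwinnertonDyer.BirchSwinnertonDyer.Theorems

end
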